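import Summits.Schanuel.Schanuel.Theorems.ZilberEacSimpleZeroBranch
import HarnessLib

/-!
# The equimodular class, LIV: an EDGE of the Newton polygon — the general one-step criterion in
# terms of root multiplicities

HONEST FRAMING.  Cell `pub-schanuel` (Zilber's Exponential-Algebraic Closedness, case ladder;
host summit Schanuel), seat 2, gen 25.  File L decides density from ONE Newton–Puiseux step given as
an identity `Q(a + t^k)(t^μ w) = t^ν Q̃(t)(w)` that the user must supply.  Here the step is read off
the rows directly (**`exists_newtonDatum_edge`**): with `m_j = rootMultiplicity a q_j` and
`ℓ_j = (q_j/(X - a)^{m_j})(a)` (the leading coefficient of `q_j` at `a`), suppose the line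
`k·m + μ·j = ν` (`k, μ ≥ 1`) SUPPORTS the Newton diagram of `Q` at `a` — `ν ≤ k m_j + μ j` whenever
`q_j ≠ 0` — and the EDGE POLYNOMIAL `E = Σ_{q_j ≠ 0, k m_j + μ j = ν} ℓ_j X^j` has a simple nonzero
root `w₀`.  Then `Q̃ := Σ_j t^{k m_j + μ j - ν} (q_j/(X-a)^{m_j})(a + t^k)·X^j` does it, with
`Q̃(0)(·) = E`.  Consequently (**`unprojectedDense_graph_newtonEdge`**) a fibre curve with one simple
nonzero top-row root and such an edge at some `a` is dense over every polynomial graph of degree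
`≥ 2`; the pole version (**`unprojectedDense_graph_newtonEdge_pole`**) is the same for the reversed
polynomial `t^r Q(s, 1/t)`.  Special cases: the unramified zero of file XLIV (edge `(0, m)–(1, 0)`),
the simple root of `q₀` of file LI (edge `(0, 1)–(k, 0)`), every edge with exactly two support
points (e.g. coprime `(k, μ)`: `E = ℓ_i X^i + ℓ_{i'} X^{i'}` has only simple nonzero roots).  What
remains undecided at a point are edges whose edge polynomial has only multiple nonzero roots
(a second Newton–Puiseux step would be needed).  Classes of instances of an OPEN question
(Mantova–Masser, PLMS 2024 §1 p. 5); EC(3,2) OPEN; NOT Schanuel's conjecture (neither used nor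
implied; EAC ⇏ SC).
-/

noncomputable section

open Filter Topology Set Complex MvPolynomial
open Literature.NumberTheory.Transcendental Literature.ModelTheory.Zilber
open Literature.ModelTheory.ExponentialFields

set_option linter.dupNamespace false

namespace Summit.Schanuel.Schanuel.Theorems

/-! ## Part A. The Newton datum of an edge -/

/-- **The Newton–Puiseux datum of an edge of the Newton diagram.**  See the module docstring.
[folklore (Newton–Puiseux), made concrete] -/
theorem exists_newtonDatum_edge (Q : Polynomial (Polynomial ℂ)) (a : ℂ) {k μ ν : ℕ} (hk : 1 ≤ k)
    (hedge : ∀ j, Q.coeff j ≠ 0 → ν ≤ k * Polynomial.rootMultiplicity a (Q.coeff j) + μ * j)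
    {w₀ : ℂ}
    (hE : (∑ j ∈ (Finset.range (Q.natDegree + 1)).filter (fun j => Q.coeff j ≠ 0 ∧
        k * Polynomial.rootMultiplicity a (Q.coeff j) + μ * j = ν),
      Polynomial.C ((Q.coeff j /ₘ (Polynomial.X - Polynomial.C a) ^
        Polynomial.rootMultiplicity a (Q.coeff j)).eval a) * Polynomial.X ^ j).IsRoot w₀)
    (hE' : ¬ (Polynomial.derivative (∑ j ∈ (Finset.range (Q.natDegree + 1)).filter (fun j => Q.coeff j ≠ 0 ∧
        k * Polynomial.rootMultiplicity a (Q.coeff j) + μ * j = ν),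
      Polynomial.C ((Q.coeff j /ₘ (Polynomial.X - Polynomial.C a) ^
        Polynomial.rootMultiplicity a (Q.coeff j)).eval a) * Polynomial.X ^ j)).IsRoot w₀) :
    ∃ Qt : Polynomial (Polynomial ℂ), (Qt.map (Polynomial.evalRingHom 0)).IsRoot w₀ ∧
      ¬ ((Polynomial.derivative Qt).map (Polynomial.evalRingHom 0)).IsRoot w₀ ∧
      ∀ t w : ℂ, t ≠ 0 → w ≠ 0 →
        (Q.map (Polynomial.evalRingHom (a + t ^ k))).eval (t ^ μ * w) =
          t ^ ν * (Qt.map (Polynomial.evalRingHom t)).eval w := by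
  classical
  set r := Q.natDegree with hr
  set m : ℕ → ℕ := fun j => Polynomial.rootMultiplicity a (Q.coeff j) with hm
  set s : ℕ → Polynomial ℂ := fun j => Q.coeff j /ₘ (Polynomial.X - Polynomial.C a) ^ m j with hs
  have hfac : ∀ j, Q.coeff j = (Polynomial.X - Polynomial.C a) ^ m j * s j := fun j =>
    (Polynomial.pow_mul_divByMonic_rootMultiplicity_eq (Q.coeff j) a).symm
  set E : Polynomial ℂ := ∑ j ∈ (Finset.range (r + 1)).filter (fun j => Q.coeff j ≠ 0 ∧
      k * m j + μ * j = ν), Polynomial.C ((s j).eval a) * Polynomial.X ^ j with hEdef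
  -- the polynomial `Q̃`
  set c : ℕ → Polynomial ℂ := fun j =>
    if Q.coeff j = 0 then 0
    else Polynomial.X ^ (k * m j + μ * j - ν) * (s j).comp (Polynomial.C a + Polynomial.X ^ k) with hc
  set Qt : Polynomial (Polynomial ℂ) := ∑ j ∈ Finset.range (r + 1), Polynomial.monomial j (c j) with hQt
  have hcoefQt : ∀ j, Qt.coeff j = if j < r + 1 then c j else 0 := by
    intro j
    rw [hQt, Polynomial.finsetSum_coeff]
    simp only [Polynomial.coeff_monomial, Finset.sum_ite_eq', Finset.mem_range]
  have hQtdeg : Qt.natDegree < r + 1 := by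
    refine Nat.lt_succ_of_le (Polynomial.natDegree_sum_le_of_forall_le _ _ fun j hj => ?_)
    exact (Polynomial.natDegree_monomial_le _).trans (Nat.lt_succ_iff.1 (Finset.mem_range.1 hj))
  -- `Q̃(0)(·) = E`
  have hc0 : ∀ j, (c j).eval 0 = if Q.coeff j ≠ 0 ∧ k * m j + μ * j = ν then (s j).eval a else 0 := by
    intro j
    simp only [hc]
    by_cases hq : Q.coeff j = 0
    · rw [if_pos hq, if_neg (fun h => h.1 hq), Polynomial.eval_zero]
    · rw [if_neg hq]
      have hν' : ν ≤ k * m j + μ * j := hedge j hq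
      by_cases hν : k * m j + μ * j = ν
      · rw [if_pos ⟨hq, hν⟩, hν, Nat.sub_self, pow_zero, one_mul, Polynomial.eval_comp, Polynomial.eval_add,
          Polynomial.eval_C, Polynomial.eval_pow, Polynomial.eval_X, zero_pow (by omega : k ≠ 0), add_zero]
      · rw [if_neg (fun h => hν h.2), Polynomial.eval_mul, Polynomial.eval_pow, Polynomial.eval_X,
          zero_pow (by omega), zero_mul]
  have hQt0 : Qt.map (Polynomial.evalRingHom 0) = E := by
    ext j
    rw [Polynomial.coeff_map, Polynomial.coe_evalRingHom, hcoefQt, hEdef, Polynomial.finsetSum_coeff]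
    simp only [Polynomial.coeff_C_mul_X_pow]
    rw [Finset.sum_ite_eq]
    simp only [Finset.mem_filter, Finset.mem_range]
    by_cases hj : j < r + 1
    · rw [if_pos hj, hc0]
      by_cases hcond : Q.coeff j ≠ 0 ∧ k * m j + μ * j = ν
      · rw [if_pos hcond, if_pos ⟨hj, hcond⟩]
      · rw [if_neg hcond, if_neg (fun h => hcond h.2)]
    · rw [if_neg hj, Polynomial.eval_zero, if_neg (fun h => hj h.1)]
  refine ⟨Qt, ?_, ?_, fun t w ht hw => ?_⟩
  · rw [hQt0]; exact hE
  · rw [← Polynomial.derivative_map, hQt0]; exact hE'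
  · -- the identity
    rw [evalPP_eq_sum Q _ _ (Nat.lt_succ_self _), evalPP_eq_sum Qt t w hQtdeg, Finset.mul_sum]
    refine Finset.sum_congr rfl fun j hj => ?_
    rw [hcoefQt, if_pos (Finset.mem_range.1 hj)]
    simp only [hc]
    by_cases hq : Q.coeff j = 0
    · rw [if_pos hq, hq]; simp
    · rw [if_neg hq]
      have hν : ν ≤ k * m j + μ * j := hedge j hq
      have hpow : (t ^ k) ^ m j * (t ^ μ) ^ j = t ^ ν * t ^ (k * m j + μ * j - ν) := by
        rw [← pow_mul, ← pow_mul, ← pow_add, ← pow_add, Nat.add_sub_cancel' hν]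
      conv_lhs => rw [hfac j]
      simp only [Polynomial.eval_mul, Polynomial.eval_pow, Polynomial.eval_sub, Polynomial.eval_X,
        Polynomial.eval_C, add_sub_cancel_left, Polynomial.eval_comp, Polynomial.eval_add, mul_pow]
      linear_combination ((s j).eval (a + t ^ k) * w ^ j) * hpow

/-! ## Part B. Surface theorems -/

/-- **An edge of the Newton diagram with a simple nonzero root of its edge polynomial suffices
(zero form).**  See the module docstring.
[cite: MantovaMasser2023, §1 Further remarks, p. 5 (the question, open in general)] (new) -/
theorem unprojectedDense_graph_newtonEdge (Q : Polynomial (Polynomial ℂ))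
    {P : MvPolynomial (Fin 2) ℂ}
    (hP : ∀ x y : ℂ, MvPolynomial.eval ![x, y] P = (Q.map (Polynomial.evalRingHom x)).eval y)
    (hirr : Irreducible P) (N : ℕ) (hN : ∀ j, (Q.coeff j).natDegree ≤ N) (T : Polynomial ℂ)
    (hT : ∀ j, T.coeff j = (Q.coeff j).coeff N) (hT0 : T ≠ 0) {θ : ℂ} (hθ0 : θ ≠ 0)
    (hTθ : T.IsRoot θ) (hT'θ : (Polynomial.derivative T).eval θ ≠ 0)
    (a : ℂ) {k μ ν : ℕ} (hk : 1 ≤ k) (hμ : 1 ≤ μ)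
    (hedge : ∀ j, Q.coeff j ≠ 0 → ν ≤ k * Polynomial.rootMultiplicity a (Q.coeff j) + μ * j)
    {w₀ : ℂ} (hw₀ : w₀ ≠ 0)
    (hE : (∑ j ∈ (Finset.range (Q.natDegree + 1)).filter (fun j => Q.coeff j ≠ 0 ∧
        k * Polynomial.rootMultiplicity a (Q.coeff j) + μ * j = ν),
      Polynomial.C ((Q.coeff j /ₘ (Polynomial.X - Polynomial.C a) ^
        Polynomial.rootMultiplicity a (Q.coeff j)).eval a) * Polynomial.X ^ j).IsRoot w₀)
    (hE' : ¬ (Polynomial.derivative (∑ j ∈ (Finset.range (Q.natDegree + 1)).filter (fun j => Q.coeff j ≠ 0 ∧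
        k * Polynomial.rootMultiplicity a (Q.coeff j) + μ * j = ν),
      Polynomial.C ((Q.coeff j /ₘ (Polynomial.X - Polynomial.C a) ^
        Polynomial.rootMultiplicity a (Q.coeff j)).eval a) * Polynomial.X ^ j)).IsRoot w₀)
    (p : Polynomial ℂ) (hd : 2 ≤ p.natDegree) :
    UnprojectedDense {w : Fin 2 ⊕ Fin 2 → ℂ | w (Sum.inl 1) = p.eval (w (Sum.inl 0)) ∧
      MvPolynomial.eval ![w (Sum.inl 0), w (Sum.inr 0)] P = 0} := by
  obtain ⟨Qt, hroot, hsimple, hid⟩ := exists_newtonDatum_edge Q a hk hedge hE hE'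
  exact unprojectedDense_graph_newtonBranch Q hP hirr N hN T hT hT0 hθ0 hTθ hT'θ a (ν := ν) hk hμ Qt hw₀
    hroot hsimple (Or.inl hid) p hd

/-- **Pole form**: the same for an edge of the Newton diagram of the reversed polynomial
`Q^rev = t^r Q(s, 1/t)` (its rows are those of `Q` in reverse order), `q₀ ≠ 0`.
[cite: MantovaMasser2023, §1 Further remarks, p. 5 (the question, open in general)] (new) -/
theorem unprojectedDense_graph_newtonEdge_pole (Q : Polynomial (Polynomial ℂ))
    {P : MvPolynomial (Fin 2) ℂ}
    (hP : ∀ x y : ℂ, MvPolynomial.eval ![x, y] P = (Q.map (Polynomial.evalRingHom x)).eval y)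
    (hirr : Irreducible P) (N : ℕ) (hN : ∀ j, (Q.coeff j).natDegree ≤ N) (T : Polynomial ℂ)
    (hT : ∀ j, T.coeff j = (Q.coeff j).coeff N) (hT0 : T ≠ 0) {θ : ℂ} (hθ0 : θ ≠ 0)
    (hTθ : T.IsRoot θ) (hT'θ : (Polynomial.derivative T).eval θ ≠ 0) (hQ00 : Q.coeff 0 ≠ 0)
    (a : ℂ) {k μ ν : ℕ} (hk : 1 ≤ k) (hμ : 1 ≤ μ)
    (hedge : ∀ j, Q.reverse.coeff j ≠ 0 → ν ≤ k * Polynomial.rootMultiplicity a (Q.reverse.coeff j) + μ * j)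
    {w₀ : ℂ} (hw₀ : w₀ ≠ 0)
    (hE : (∑ j ∈ (Finset.range (Q.reverse.natDegree + 1)).filter (fun j => Q.reverse.coeff j ≠ 0 ∧
        k * Polynomial.rootMultiplicity a (Q.reverse.coeff j) + μ * j = ν),
      Polynomial.C ((Q.reverse.coeff j /ₘ (Polynomial.X - Polynomial.C a) ^
        Polynomial.rootMultiplicity a (Q.reverse.coeff j)).eval a) * Polynomial.X ^ j).IsRoot w₀)
    (hE' : ¬ (Polynomial.derivative (∑ j ∈ (Finset.range (Q.reverse.natDegree + 1)).filter
        (fun j => Q.reverse.coeff j ≠ 0 ∧ k * Polynomial.rootMultiplicity a (Q.reverse.coeff j) + μ * j = ν),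
      Polynomial.C ((Q.reverse.coeff j /ₘ (Polynomial.X - Polynomial.C a) ^
        Polynomial.rootMultiplicity a (Q.reverse.coeff j)).eval a) * Polynomial.X ^ j)).IsRoot w₀)
    (p : Polynomial ℂ) (hd : 2 ≤ p.natDegree) :
    UnprojectedDense {w : Fin 2 ⊕ Fin 2 → ℂ | w (Sum.inl 1) = p.eval (w (Sum.inl 0)) ∧
      MvPolynomial.eval ![w (Sum.inl 0), w (Sum.inr 0)] P = 0} := by
  classical
  obtain ⟨Qt, hroot, hsimple, hid⟩ := exists_newtonDatum_edge Q.reverse a hk hedge hE hE'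
  refine unprojectedDense_graph_newtonBranch Q hP hirr N hN T hT hT0 hθ0 hTθ hT'θ a (ν := ν) hk hμ Qt hw₀
    hroot hsimple (Or.inr ⟨hQ00, fun t w ht hw => ?_⟩) p hd
  have hx0 : t ^ μ * w ≠ 0 := mul_ne_zero (pow_ne_zero _ ht) hw
  haveI := invertibleOfNonzero (inv_ne_zero hx0)
  have h := Polynomial.eval₂_reverse_mul_pow (Polynomial.evalRingHom (a + t ^ k)) (t ^ μ * w)⁻¹ Q
  rw [invOf_eq_inv, inv_inv] at h
  have hid1 := hid t w ht hw
  rw [Polynomial.eval_map] at hid1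
  rw [Polynomial.eval_map, ← hid1, ← h, inv_pow]
  field_simp

end Summit.Schanuel.Schanuel.Theorems
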